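import Summits.MatrixMultiplication.MatrixMultiplication.Theorems.AbelianSTPPCensusLeafTA6833Closed
import Summits.MatrixMultiplication.MatrixMultiplication.Theorems.AbelianSTPPCensusTASharp6834VQ

/-!
# T_A: the static-certificate hypotheses vM ∪ U11-G ∪ E3 exclude beating `2.371` exactly up to order 6833

Cell mm-stpp (rung F-M1), tier T_A = «beat `2.371`, the record exponent (ADVXXZ'25 / DEK+26 rounded)»; seat mm-stpp-vp-p2 (gen 7); PRE-REG v1 band B2⁺.
Bookkeeping conjunction of two landed kernel facts, stated once so that the census can cite ONE declaration for «T_A is closed for the hypothesis set»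
(pattern: `AbelianSTPPCensusTCStaticCertificateExact.lean`, vp-p2 gen 6): (a) `TAStatF.not_beats_2371` (`AbelianSTPPCensusLeafTA6833Closed.lean`, multi-parameter
k-member tree in the root-split kernel layout): at every order `6780 ≤ M ≤ 6833` no shape list with ≥ 2 members that is `SieveAdmissible M ∧ U11G M ∧ TAKnap575.E3Adm M`
beats `2371/1000` (the orders `≤ 6779` are the earlier leaves); (b) theory g12's `TALinWall.w6834_*` (`AbelianSTPPCensusTASharp6834VQ.lean`): at `M = 6834` such a
list exists (`(15,15,18) + (15,16,16)⁵ + (16,16,15)⁴`, i.e. `vmU11GE3CensusTA_false_at_6834`).  Hence no certificate whose only inputs are these three rule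
families can move the T_A kernel column beyond `6833`, and `6833` is attained (`noAbelianSTPPHostUpTo_2371_6833`).
WHAT THIS IS NOT: no existence claim for an STPP family at order 6834 (the list is rule-admissible only); no `ω` statement; nothing about other tiers.
-/

set_option linter.dupNamespace false
set_option autoImplicit false

namespace Summit.MatrixMultiplication.MatrixMultiplication.Theorems

/-- **T_A static certificate, both ends.**  vM ∪ U11-G ∪ E3 exclude beating `2371/1000` at every order `6780 … 6833`, and admit a beating list at `6834`. [original] -/
theorem taStaticCertificate_exact_6833 :
    (∀ (N M : ℕ) (a b c : Fin N → ℕ), 2 ≤ N → 6780 ≤ M → M ≤ 6833 →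
        SieveAdmissible M a b c → U11G M a b c → TAKnap575.E3Adm M a b c → ¬ Beats (2371 / 1000) M a b c) ∧
      (∃ (a b c : Fin 10 → ℕ), SieveAdmissible 6834 a b c ∧ U11G 6834 a b c ∧ TAKnap575.E3Adm 6834 a b c ∧ Beats (2371 / 1000) 6834 a b c) :=
  ⟨TAStatF.not_beats_2371, ⟨_, _, _, TALinWall.w6834_sieveAdmissible, TALinWall.w6834_u11g, TALinWall.w6834_e3Adm, TALinWall.w6834_beats⟩⟩

/-- **T_A/6833 with its wall**: no abelian STPP host of order `≤ 6833` beats `2.371` (kernel), while the hypothesis set of every landed T_A certificate is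
satisfied by a beating list at `6834`. [original] -/
theorem noAbelianSTPPHostUpTo_2371_6833_and_wall :
    NoAbelianSTPPHostUpTo (2371 / 1000) 6833 ∧
      (∃ (a b c : Fin 10 → ℕ), SieveAdmissible 6834 a b c ∧ U11G 6834 a b c ∧ TAKnap575.E3Adm 6834 a b c ∧ Beats (2371 / 1000) 6834 a b c) :=
  ⟨noAbelianSTPPHostUpTo_2371_6833, ⟨_, _, _, TALinWall.w6834_sieveAdmissible, TALinWall.w6834_u11g, TALinWall.w6834_e3Adm, TALinWall.w6834_beats⟩⟩

end Summit.MatrixMultiplication.MatrixMultiplication.Theorems
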